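import Literature.NumberTheory.EllipticCurves.ComplexMultiplicationBSDTripleCasselsProofs
import Literature.NumberTheory.EllipticCurves.IsogenyMordellWeilRankProofs
import HarnessLib

/-!
# Milne's Theorem I.7.3 (truth form) from Knapp 11.67 and Cassels' quotient form alone

Fourth sibling proof file of `Literature.NumberTheory.EllipticCurves.ComplexMultiplication` around
the named fact `Literature.NumberTheory.EllipticCurves.bsdTriple_of_hasCM_of_L_one_ne_zero`
(bsd.S28, geometric-CM form). `ComplexMultiplicationBSDTripleCasselsProofs.lean` proved
`WeierstrassCurve.bsdTriple_iff_of_isIsogenous_of_facts`: the truth form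
`WeierstrassCurve.bsdTriple_iff_of_isIsogenous` of the isogeny invariance of the
Birch–Swinnerton-Dyer conjecture (Milne, *Arithmetic Duality Theorems*, Thm. I.7.3; for elliptic
curves Cassels 1965) follows from Knapp's Thm. 11.67
(`Literature.NumberTheory.EllipticCurves.LFunction_eq_of_isIsogenous`), the isogeny invariance of
the Mordell–Weil rank (`WeierstrassCurve.mordellWeilRank_eq_of_isIsogenous`) and Cassels' quotient
invariance (`WeierstrassCurve.bsdRHS_eq_of_isIsogenous`). The rank input has since been
**discharged** (`WeierstrassCurve.mordellWeilRank_eq_of_isIsogenous_holds`,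
`IsogenyMordellWeilRankProofs.lean`: an isogeny descends to a homomorphism `E(K) → E'(K)` with
torsion kernel, and the dual isogeny bounds the rank the other way), so this file records the
truth form — and the descent of `BSDTriple` along a `ℚ`-isogeny in arbitrary rank — from **Knapp
11.67 and Cassels' quotient invariance alone**, the two isogeny facts that every level `≥ 3` of the
Burungale–Flach chain (`ComplexMultiplicationBurungaleFlachDescentProofs.lean`) already assumes.
Kept in its own file so that the sharp bsd.S28 assembly
(`ComplexMultiplicationBSDTripleTableProofs.lean`) does not depend on the rank file.

## References

* J. S. Milne, *Arithmetic Duality Theorems*, 2nd ed. (2006), I.7: Lemma 7.1 (p. 96), Thm. 7.3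
  (p. 97: "`r` is the common rank of the groups of `K`-rational points"), (7.3.1) (p. 98), Notes
  (p. 101: "For elliptic curves, Theorem 7.3 was proved by Cassels (1965)"). [MilneADT2006]
* J. W. S. Cassels, *Arithmetic on curves of genus 1. VIII*, J. reine angew. Math. 217 (1965).
  [Cassels1965ArithmeticVIII]
* A. W. Knapp, *Elliptic Curves*, Princeton (1992), Thm. 11.67. [Knapp1993]
-/

noncomputable section

open scoped Classical

namespace WeierstrassCurve

open Literature.NumberTheory.EllipticCurves

/-- **BSD descends along a `ℚ`-isogeny, from Knapp 11.67 and Cassels' quotient invariance alone**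
(arbitrary rank): `bsdTriple_of_isIsogenous_of_facts` with its Mordell–Weil rank input supplied by
the discharged `mordellWeilRank_eq_of_isIsogenous_holds`.
[cite: MilneADT2006, Thm. I.7.3 (p. 97) with Lemma I.7.1 (p. 96)] [cite: Cassels1965ArithmeticVIII]
[cite: Knapp1993, Thm. 11.67] -/
theorem bsdTriple_of_isIsogenous_of_LFunction_of_bsdRHS
    (hKn : LFunction_eq_of_isIsogenous) (hISO : bsdRHS_eq_of_isIsogenous)
    {W W' : WeierstrassCurve ℚ} [W.IsElliptic] [W'.IsElliptic] [W.IsGloballyMinimal]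
    [W'.IsGloballyMinimal] (hiso : IsIsogenous W W') (h' : W'.BSDTriple) : W.BSDTriple :=
  bsdTriple_of_isIsogenous_of_facts hKn mordellWeilRank_eq_of_isIsogenous_holds hISO hiso h'

/-- **Milne's Theorem I.7.3 (truth form, `WeierstrassCurve.bsdTriple_iff_of_isIsogenous`) from
Knapp 11.67 and Cassels' quotient invariance alone**: `bsdTriple_iff_of_isIsogenous_of_facts` with
the rank input discharged (`mordellWeilRank_eq_of_isIsogenous_holds`). So that named fact reduces
to the two isogeny facts `LFunction_eq_of_isIsogenous` and `bsdRHS_eq_of_isIsogenous`.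
[cite: MilneADT2006, Thm. I.7.3 (p. 97) with Lemma I.7.1 (p. 96) and (7.3.1) (p. 98)]
[cite: Cassels1965ArithmeticVIII] -/
theorem bsdTriple_iff_of_isIsogenous_of_LFunction_of_bsdRHS
    (hKn : LFunction_eq_of_isIsogenous) (hISO : bsdRHS_eq_of_isIsogenous) :
    bsdTriple_iff_of_isIsogenous :=
  bsdTriple_iff_of_isIsogenous_of_facts hKn mordellWeilRank_eq_of_isIsogenous_holds hISO

end WeierstrassCurve

end
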